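/-
Copyright (c) 2026 the pub-hodgecm-mathlib formalisation cell (harness21).  Prover seat hodgecm-mathlib-B-p10 (g27), 2026-09-01.  F0∕P3b «QCMTS ⟸ ST»
(LEAD F0P3a-plan (g10) T9-38 (2) ∕ T9-40 (d4); P3b desk (g14)): the P3b line's Lines-local pieces, re-resident under `Theorems/`.
-/
import Literature.NumberTheory.Rogawski1990.CMCharIdentityClauses              -- ★ the letters of record: `CMCharIdentityClauses`/`Package`, `OneDimAutRepH.xiLocalChar`, `cmSplitPacket`, `KeysCaseTwoLabels`, `Gqs`, `cmDatumLocalCongr`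
import Literature.NumberTheory.Rogawski1990.LocalTransferFundamentalLemma       -- ★ `IsLocSmooth` (the test class of ★ `LocalTransferExplicit` = closer `stub_N6`)
import Literature.NumberTheory.Rogawski1990.CharIdentityOnTestFunctions         -- ★ A-p19 (g21) R1∕R2: `CMCharIdentityPackageTest` & the Test twins (the head, BY NAME)
import Literature.NumberTheory.Rogawski1990.FinExplicitTransferFactorConjRight  -- ★ `finExplicitCollection`, `finExplicitDelta_conj_left_all/right_all` (the `Δ‴` of record)
import Literature.NumberTheory.Automorphic.GodementHeightFloor                  -- ★ `Godement.det_ne_zero_of_anisotropic`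
import Literature.NumberTheory.Automorphic.OrbitalMeasureCanonical              -- ★ `OrbitalMeasureFamily.IsCanonical` (canonical measures of record)
import Literature.NumberTheory.Automorphic.UnitaryGroupConstantTermSplit       -- ★ typer D1 (B-p18 (g31)): `cmSplitTransfer` = `τ_v · f̄^P`, the split-place transfer map NAMED (ED. 5)
import Summits.HodgeConjecture.HodgeConjecture.Theorems.F0P3bCharDistReduction  -- ★ p840692 A-p19 (g21): (C2-red) CLOSED — `charDistReduction` (ED. 6 fold)
import Literature.NumberTheory.Rogawski1990.SmoothTransferSplitPlaceNamed  -- ★ p840736 B-p18 (g31) F3: (a) CLOSED — `splitTransferIsTransfer` (ED. 6 fold)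
import Summits.HodgeConjecture.HodgeConjecture.Theorems.F0P3bXiStablyInvariant  -- ★ p840939 A-p19 (g21): (C1) CLOSED — `xiStablyInvariant` (ED. 7 fold)
import Summits.HodgeConjecture.HodgeConjecture.Theorems.F0P3bPrincipalSeriesTrace  -- ★ p840990 F0P2-p06 (g6): (P) CLOSED — `principalSeriesTrace` (ED. 7 fold)
import Summits.HodgeConjecture.HodgeConjecture.Theorems.F0P3bVanDijkSplitOfGL  -- ★ p841093∕p841114 B-p18 (g31): (b) ⇐ van Dijk GL₃ — `vanDijkSplit_of_vanDijkGL'` (ED. 8 split by name)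
import Literature.NumberTheory.Automorphic.UnitaryGroupPrincipalSeriesH    -- ★ p840539 typer D2 (A-p19 pen): `cmPrincipalSeriesH`, `HLengthTwoLabels` (ED. 9 cut of the non-split letter)
import Literature.NumberTheory.Automorphic.SmoothCharacterOfCharacter                     -- ★ p841475 (commit f9f38c1351c4; N-H-i): `SmoothIrrep.ofChar`, `IrrClass.smoothTrace_mk_ofChar_of_mem`
import Summits.HodgeConjecture.HodgeConjecture.Theorems.F0P3bVanDijkGL  -- ★ B-p18 (g31) closer of (b-GL): `vanDijkGL` over ★ p841625 `GLn.vanDijkTraceParabolicIndGL_holds`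
import Summits.HodgeConjecture.HodgeConjecture.Theorems.F0P3bHPrincipalSeriesJHOfUTwo  -- ★ p842330 (commit 54faa5f3651e) F0P2-p06 (g7): (N-H-ii′) ⇐ (JH₂) — `hPrincipalSeriesJH_of_uTwo` (ED. 12 split by name)
import Summits.HodgeConjecture.HodgeConjecture.Theorems.F0P3bU2PrincipalSeriesJHOfBricks  -- ★ p842461 F0P2-p06 (g7): JUNCTION `uTwoPrincipalSeriesJH_of_bricks` ((JH₂) ⟸ (H3) + (H4) + (EIG)), ED. 13 split BY NAME
import Summits.HodgeConjecture.HodgeConjecture.Theorems.F0P3bU2NoCharacterEigenvector   -- ★ p842646 F0P2-p06 (g7): (EIG) `no_char_eigenvector_cmPrincipalSeries_two`, CLOSES slot 3 of the junction BY NAME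
import Literature.NumberTheory.Rogawski1990.CharIdentityOnTestFunctionsSigned   -- ★ p842701 A-p16 (g27): K2 typing brick (QS-DEF) `CMCharIdentityPackageTestSigned` — the ED. 14 head BY NAME
import Summits.HodgeConjecture.HodgeConjecture.Theorems.F0P3bU2XiQuotientFunctional  -- ★ p843847 (commit 7deb8bcac0c7) F0P2-p06 (g7): (H4) closer `xi_quotient_functional` = the `hQ` binder VERBATIM (part 1 ★ p843771 `F0P3bU2XiSphericalVector`)
import Summits.HodgeConjecture.HodgeConjecture.Theorems.F0P3bWeylVanishingSplit  -- ★ p843914 (commit 4aeeab504936) F0P3b-p01 (g8): (W1s) closer `weylVanishingSplit` (W-E of the soft-Weyl road, 11 ★)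
import Summits.HodgeConjecture.HodgeConjecture.Theorems.F0P3bHPrincipalSeriesJHHolds  -- ★ p843962 F0P2-p06 (g7): (H3) closer `hHC_holds` (HC criterion for `U(Φ₂)`, hypothesis-free; also `uTwoPrincipalSeriesJH_holds`, `hPrincipalSeriesJH_holds`)
import Summits.HodgeConjecture.HodgeConjecture.Theorems.F0P3bInducedCharTransferSigned  -- ★ p844043 B-p18 (g33): (N-492S) closer `inducedCharTransferSigned` (road S0–S4 ★; B-p18 g31–g33 + F0P3b-p01 g7)
import HarnessLib

/-!
# «QCMTS ⟸ ST» — PART 1: the split-place identity, stable Weyl vanishing, character-distribution stability and the `H`-side labels of the P3b line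
# `Cruxes/H413/Lines/F0_P3b_CMCharIdentityTestPaydown.lean` (ED. 18, 8c90ff557acce548), PORTED VERBATIM to a Theorems-resident module

Crux H413 = `stmt-HodgeConjecture-24833` (`--supports` only).  THEOREMS ONLY (no definition, no instance, no notation, no named fact, no `sorry`); no `Lines`
import.  WHY: the closer's registered `stub_QCMTS` (`Cruxes/H413/Lines/F0_U3LettersRung1.lean` ED. 28 :770) is to be DERIVED from the ONE printed local lemma
(N-1273S) `stub_steinbergCharTransferSigned` [Rogawski1990 Prop. 12.7.3] by a Theorems-level sorry-free concluder `qcmtSigned_of_steinbergCharTransferSigned`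
(LEAD T9-38 (2)); a Lines file cannot be imported, so the line's six Lines-local proofs are re-homed here (PART 1) and in `F0P3bQCMTSignedOfSteinberg` (PART 2 =
the concluder).  EVERY statement below is the line's, with (i) the reducible abbreviations `Pl ∕ HLoc ∕ GLoc` UNFOLDED textually and (ii) each `type_of% stub_X`
hypothesis re-keyed to the ★ declaration that closes `stub_X` BY NAME in the line (ED. 6–18 folds); every PROOF is the line's, byte-identical modulo those
two substitutions.  Seat B-p10 (g27); census `B-provers/B-p10/g27/CENSUS-QCMTS-of-ST.B-p10g27.md` adf5dccda092d47e.
HONEST LABEL: HC_CM is proved only modulo the 2 remaining named inputs (hLiu418 24832, h413 24833) until rung 0 closes; nothing printed is asserted here.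

* `splitTransferIdentity_of_line` (line :422; over ★ `splitTransferIsTransfer` + ★ `vanDijkSplit_of_vanDijkGL' vanDijkGL`).
* `stableWeylVanishing_of_split` (:488; over ★ `weylVanishingSplit`).
* `charDistStableOfInvariant_of_line`, `charDistStable_of_split` (:542, :560; over ★ `xiStablyInvariant`, ★ `weylVanishingSplit`, ★ `charDistReduction`).
* `hPrincipalSeriesLabels_of_JH` (:698; over ★ `hPrincipalSeriesJH_of_uTwo (uTwoPrincipalSeriesJH_of_bricks hHC_holds xi_quotient_functional no_char_eigenvector_…)`).

## References
* [Rogawski1990] J. D. Rogawski, *Automorphic Representations of Unitary Groups in Three Variables*, Ann. of Math. Stud. 123 (1990): §4.13 Lemma 4.13.1 pp. 64–66;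
  §12.1 pp. 171–172; §12.7 Cor. 12.7.4 p. 188; §13.1 Prop. 13.1.4 p. 199.
* [HarishChandra1970] Harish-Chandra, *Harmonic analysis on reductive p-adic groups*, LNM 162 (1970): Lemma 42.
* [Casselman1995] W. Casselman, *Introduction to the theory of admissible representations of p-adic reductive groups* (1995): Cor. 7.1.2.
-/

set_option autoImplicit false
set_option linter.dupNamespace false

noncomputable section

open NumberField IsDedekindDomain MeasureTheory
open scoped Matrix MatrixGroups
open Literature.NumberTheory.Rogawski1990 Literature.NumberTheory.Automorphic Literature.NumberTheory.Automorphic.UnitaryGroup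
open Literature.NumberTheory.Automorphic.UnitaryGroup.CotangentForms Literature.NumberTheory.GaloisRepresentations
open Literature.NumberTheory.Automorphic.Arthur2013.Leaves.TECR

namespace Summit.HodgeConjecture.HodgeConjecture.Cruxes.H413.F0P3bQCMTSignedOfLinePieces

/-- **ED. 4's `stub_splitTransferIdentity` from (a) + (b)** (ED. 5): the witness is `f^P := cmSplitTransfer … f` (`∃`-intro). [cite: Rogawski1990, §4.13 Lemma 4.13.1 pp. 64–66] -/
theorem splitTransferIdentity_of_line (hA : type_of% @Literature.NumberTheory.Rogawski1990.splitTransferIsTransfer) (hB : type_of% (F0P3bVanDijkSplitOfGL.vanDijkSplit_of_vanDijkGL' F0P3bVanDijkGL.vanDijkGL)) :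
  ∀ (L : Type) [Field L] [NumberField L] [IsCMField L] (H : Matrix (Fin 3) (Fin 3) L) (μ : HeckeCharacter L)
    [∀ v : (HeightOneSpectrum (𝓞 ↥(maximalRealSubfield L))), MeasurableSpace (((UnitaryGroup.cmDatum L 2 (Matrix.of fun i j : Fin 2 => if i.val + j.val + 1 = 2 then (1 : L) else 0)).Local v × (UnitaryGroup.cmDatum L 1 (Matrix.of fun i j : Fin 1 => if i.val + j.val + 1 = 1 then (1 : L) else 0)).Local v))] [∀ v : (HeightOneSpectrum (𝓞 ↥(maximalRealSubfield L))), BorelSpace (((UnitaryGroup.cmDatum L 2 (Matrix.of fun i j : Fin 2 => if i.val + j.val + 1 = 2 then (1 : L) else 0)).Local v × (UnitaryGroup.cmDatum L 1 (Matrix.of fun i j : Fin 1 => if i.val + j.val + 1 = 1 then (1 : L) else 0)).Local v))]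
    [∀ v : (HeightOneSpectrum (𝓞 ↥(maximalRealSubfield L))), MeasurableSpace (((UnitaryGroup.cmDatum L 3 H).Local v))] [∀ v : (HeightOneSpectrum (𝓞 ↥(maximalRealSubfield L))), BorelSpace (((UnitaryGroup.cmDatum L 3 H).Local v))]
    (νH : ∀ v : (HeightOneSpectrum (𝓞 ↥(maximalRealSubfield L))), Measure (((UnitaryGroup.cmDatum L 2 (Matrix.of fun i j : Fin 2 => if i.val + j.val + 1 = 2 then (1 : L) else 0)).Local v × (UnitaryGroup.cmDatum L 1 (Matrix.of fun i j : Fin 1 => if i.val + j.val + 1 = 1 then (1 : L) else 0)).Local v))) (νG : ∀ v : (HeightOneSpectrum (𝓞 ↥(maximalRealSubfield L))), Measure (((UnitaryGroup.cmDatum L 3 H).Local v)))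
    [∀ v, (νH v).IsHaarMeasure] [∀ v, (νH v).IsMulRightInvariant] [∀ v, (νG v).IsHaarMeasure] [∀ v, (νG v).IsMulRightInvariant]
    (hμu : μ.IsUnitary)
    (_hμω : ∀ x : Literature.NumberTheory.GaloisRepresentations.ideleGroup ↥(maximalRealSubfield L),
      μ (AdeleRing.ideleBaseChange (↥(maximalRealSubfield L)) L x) = quadraticHeckeCharCM L x)
    (hherm : (H.map (cmConjRingHom L))ᵀ = H)
    (hanis : ∀ x : Fin 3 → L, Literature.AlgebraicGeometry.ShimuraVarieties.hermForm (cmConjRingHom L) H x x = 0 → x = 0),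
    letI : ∀ (v : (HeightOneSpectrum (𝓞 ↥(maximalRealSubfield L)))) (a : ((UnitaryGroup.cmDatum L 2 (Matrix.of fun i j : Fin 2 => if i.val + j.val + 1 = 2 then (1 : L) else 0)).Local v × (UnitaryGroup.cmDatum L 1 (Matrix.of fun i j : Fin 1 => if i.val + j.val + 1 = 1 then (1 : L) else 0)).Local v)), MeasurableSpace (((UnitaryGroup.cmDatum L 2 (Matrix.of fun i j : Fin 2 => if i.val + j.val + 1 = 2 then (1 : L) else 0)).Local v × (UnitaryGroup.cmDatum L 1 (Matrix.of fun i j : Fin 1 => if i.val + j.val + 1 = 1 then (1 : L) else 0)).Local v) ⧸ Subgroup.centralizer ({a} : Set (((UnitaryGroup.cmDatum L 2 (Matrix.of fun i j : Fin 2 => if i.val + j.val + 1 = 2 then (1 : L) else 0)).Local v × (UnitaryGroup.cmDatum L 1 (Matrix.of fun i j : Fin 1 => if i.val + j.val + 1 = 1 then (1 : L) else 0)).Local v)))) := fun _ _ => borel _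
    haveI : ∀ (v : (HeightOneSpectrum (𝓞 ↥(maximalRealSubfield L)))) (a : ((UnitaryGroup.cmDatum L 2 (Matrix.of fun i j : Fin 2 => if i.val + j.val + 1 = 2 then (1 : L) else 0)).Local v × (UnitaryGroup.cmDatum L 1 (Matrix.of fun i j : Fin 1 => if i.val + j.val + 1 = 1 then (1 : L) else 0)).Local v)), BorelSpace (((UnitaryGroup.cmDatum L 2 (Matrix.of fun i j : Fin 2 => if i.val + j.val + 1 = 2 then (1 : L) else 0)).Local v × (UnitaryGroup.cmDatum L 1 (Matrix.of fun i j : Fin 1 => if i.val + j.val + 1 = 1 then (1 : L) else 0)).Local v) ⧸ Subgroup.centralizer ({a} : Set (((UnitaryGroup.cmDatum L 2 (Matrix.of fun i j : Fin 2 => if i.val + j.val + 1 = 2 then (1 : L) else 0)).Local v × (UnitaryGroup.cmDatum L 1 (Matrix.of fun i j : Fin 1 => if i.val + j.val + 1 = 1 then (1 : L) else 0)).Local v)))) := fun _ _ => ⟨rfl⟩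
    letI : ∀ (v : (HeightOneSpectrum (𝓞 ↥(maximalRealSubfield L)))) (γ : ((UnitaryGroup.cmDatum L 3 H).Local v)), MeasurableSpace (((UnitaryGroup.cmDatum L 3 H).Local v) ⧸ Subgroup.centralizer ({γ} : Set (((UnitaryGroup.cmDatum L 3 H).Local v)))) := fun _ _ => borel _
    haveI : ∀ (v : (HeightOneSpectrum (𝓞 ↥(maximalRealSubfield L)))) (γ : ((UnitaryGroup.cmDatum L 3 H).Local v)), BorelSpace (((UnitaryGroup.cmDatum L 3 H).Local v) ⧸ Subgroup.centralizer ({γ} : Set (((UnitaryGroup.cmDatum L 3 H).Local v)))) := fun _ _ => ⟨rfl⟩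
    ∀ (mH : ∀ v : (HeightOneSpectrum (𝓞 ↥(maximalRealSubfield L))), OrbitalMeasureFamily (((UnitaryGroup.cmDatum L 2 (Matrix.of fun i j : Fin 2 => if i.val + j.val + 1 = 2 then (1 : L) else 0)).Local v × (UnitaryGroup.cmDatum L 1 (Matrix.of fun i j : Fin 1 => if i.val + j.val + 1 = 1 then (1 : L) else 0)).Local v))) (mG : ∀ v : (HeightOneSpectrum (𝓞 ↥(maximalRealSubfield L))), OrbitalMeasureFamily (((UnitaryGroup.cmDatum L 3 H).Local v))),
      (∀ v : (HeightOneSpectrum (𝓞 ↥(maximalRealSubfield L))), (mH v).IsCanonical (IsLocalGRegular L v) (νH v) ∧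
          (mG v).IsCanonical (fun γ => IsRegularElt (γ.val : GL (Fin 3) (UnitaryGroup.LocalRing L v))) (νG v)) →
      ∀ (ξ : OneDimAutRepH L) (v : (HeightOneSpectrum (𝓞 ↥(maximalRealSubfield L)))) (hs : ∃ w : PlacesOver L v, IsCMField.complexConj L • w.1 ≠ w.1)
        (f : ((UnitaryGroup.cmDatum L 3 H).Local v) → ℂ), IsLocSmooth f →
        ∃ fP : ((UnitaryGroup.cmDatum L 2 (Matrix.of fun i j : Fin 2 => if i.val + j.val + 1 = 2 then (1 : L) else 0)).Local v × (UnitaryGroup.cmDatum L 1 (Matrix.of fun i j : Fin 1 => if i.val + j.val + 1 = 1 then (1 : L) else 0)).Local v) → ℂ, IsLocSmooth fP ∧ IsLocalDeltaTransfer L H v ((finExplicitCollection L H μ (finExplicitDelta_conj_left_all L H μ) (finExplicitDelta_conj_right_all L H μ)) v) (mH v) (mG v) fP f ∧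
          charDist (ξ.xiLocalChar v) (νH v) fP = ((cmSplitPacket L H hherm (isUnit_iff_ne_zero.mpr (Godement.det_ne_zero_of_anisotropic L H hanis)) v (splitWitness v hs) (splitWitness_spec v hs) (ξ.splitν₀ μ (splitWitness v hs).1)
              (ξ.locψ (splitWitness v hs).1) (ξ.norm_splitν₀_apply hμu (splitWitness v hs).1)
              (ξ.continuous_splitν₀ μ (splitWitness v hs).1) (ξ.norm_locψ_apply (splitWitness v hs).1)
              (ξ.continuous_locψ (splitWitness v hs).1)).πn).smoothTrace (νG v) f := by
  intro L _ _ _ H μ _ _ _ _ νH νG _ _ _ _ hμu hμω hherm hanis mH mG hcan ξ v hs f hf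
  exact ⟨_, (hA L H μ νH νG hμu hμω hherm hanis mH mG hcan v hs f hf).1, (hA L H μ νH νG hμu hμω hherm hanis mH mG hcan v hs f hf).2,
    hB L H μ νH νG hμu hμω hherm hanis ξ v hs f hf⟩

/-- JUNCTION (ED. 15): (W1s) ⇒ (W1) AT SPLIT PLACES — at a split `v`, `Φ^st_H(γ_H, g) = Φ([γ_H], g)` for every `γ_H` (★ `stableOrbitalIntegralRel_isLocalStablyConjH_eq_of_split`;
its frame side conditions `ᵗΦ̄ᵢ = Φᵢ`, `det Φᵢ ≠ 0` by `fin_cases` ∕ `Matrix.det_fin_two`), so vanishing `G`-regular STABLE orbital integrals are vanishing CLASS orbital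
integrals. [cite: Rogawski1990, §14.2 p. 232; §4.1 (4.1.1) p. 40] -/
theorem stableWeylVanishing_of_split (hW : type_of% @F0P3bWeylVanishingSplit.weylVanishingSplit) :
  ∀ (L : Type) [Field L] [NumberField L] [IsCMField L] (v : (HeightOneSpectrum (𝓞 ↥(maximalRealSubfield L)))), (∃ w : PlacesOver L v, IsCMField.complexConj L • w.1 ≠ w.1) →
    ∀ [MeasurableSpace (((UnitaryGroup.cmDatum L 2 (Matrix.of fun i j : Fin 2 => if i.val + j.val + 1 = 2 then (1 : L) else 0)).Local v × (UnitaryGroup.cmDatum L 1 (Matrix.of fun i j : Fin 1 => if i.val + j.val + 1 = 1 then (1 : L) else 0)).Local v))] [BorelSpace (((UnitaryGroup.cmDatum L 2 (Matrix.of fun i j : Fin 2 => if i.val + j.val + 1 = 2 then (1 : L) else 0)).Local v × (UnitaryGroup.cmDatum L 1 (Matrix.of fun i j : Fin 1 => if i.val + j.val + 1 = 1 then (1 : L) else 0)).Local v))] (νH : Measure (((UnitaryGroup.cmDatum L 2 (Matrix.of fun i j : Fin 2 => if i.val + j.val + 1 = 2 then (1 : L) else 0)).Local v × (UnitaryGroup.cmDatum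 L 1 (Matrix.of fun i j : Fin 1 => if i.val + j.val + 1 = 1 then (1 : L) else 0)).Local v))) [νH.IsHaarMeasure] [νH.IsMulRightInvariant],
    letI : ∀ a : ((UnitaryGroup.cmDatum L 2 (Matrix.of fun i j : Fin 2 => if i.val + j.val + 1 = 2 then (1 : L) else 0)).Local v × (UnitaryGroup.cmDatum L 1 (Matrix.of fun i j : Fin 1 => if i.val + j.val + 1 = 1 then (1 : L) else 0)).Local v), MeasurableSpace (((UnitaryGroup.cmDatum L 2 (Matrix.of fun i j : Fin 2 => if i.val + j.val + 1 = 2 then (1 : L) else 0)).Local v × (UnitaryGroup.cmDatum L 1 (Matrix.of fun i j : Fin 1 => if i.val + j.val + 1 = 1 then (1 : L) else 0)).Local v) ⧸ Subgroup.centralizer ({a} : Set (((UnitaryGroup.cmDatum L 2 (Matrix.of fun i j : Fin 2 => if i.val + j.val + 1 = 2 then (1 : L) else 0)).Local v × (UnitaryGroup.cmDatum L 1 (Matrix.of fun i j : Fin 1 => if i.val + j.val + 1 = 1 then (1 : L) else 0)).Local v)))) := fun _ => borel _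
    haveI : ∀ a : ((UnitaryGroup.cmDatum L 2 (Matrix.of fun i j : Fin 2 => if i.val + j.val + 1 = 2 then (1 : L) else 0)).Local v × (UnitaryGroup.cmDatum L 1 (Matrix.of fun i j : Fin 1 => if i.val + j.val + 1 = 1 then (1 : L) else 0)).Local v), BorelSpace (((UnitaryGroup.cmDatum L 2 (Matrix.of fun i j : Fin 2 => if i.val + j.val + 1 = 2 then (1 : L) else 0)).Local v × (UnitaryGroup.cmDatum L 1 (Matrix.of fun i j : Fin 1 => if i.val + j.val + 1 = 1 then (1 : L) else 0)).Local v) ⧸ Subgroup.centralizer ({a} : Set (((UnitaryGroup.cmDatum L 2 (Matrix.of fun i j : Fin 2 => if i.val + j.val + 1 = 2 then (1 : L) else 0)).Local v × (UnitaryGroup.cmDatum L 1 (Matrix.of fun i j : Fin 1 => if i.val + j.val + 1 = 1 then (1 : L) else 0)).Local v)))) := fun _ => ⟨rfl⟩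
    ∀ (mH : OrbitalMeasureFamily (((UnitaryGroup.cmDatum L 2 (Matrix.of fun i j : Fin 2 => if i.val + j.val + 1 = 2 then (1 : L) else 0)).Local v × (UnitaryGroup.cmDatum L 1 (Matrix.of fun i j : Fin 1 => if i.val + j.val + 1 = 1 then (1 : L) else 0)).Local v))), mH.IsCanonical (IsLocalGRegular L v) νH →
      ∀ (g : ((UnitaryGroup.cmDatum L 2 (Matrix.of fun i j : Fin 2 => if i.val + j.val + 1 = 2 then (1 : L) else 0)).Local v × (UnitaryGroup.cmDatum L 1 (Matrix.of fun i j : Fin 1 => if i.val + j.val + 1 = 1 then (1 : L) else 0)).Local v) → ℂ), IsLocSmooth g →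
        (∀ a : ((UnitaryGroup.cmDatum L 2 (Matrix.of fun i j : Fin 2 => if i.val + j.val + 1 = 2 then (1 : L) else 0)).Local v × (UnitaryGroup.cmDatum L 1 (Matrix.of fun i j : Fin 1 => if i.val + j.val + 1 = 1 then (1 : L) else 0)).Local v), IsLocalGRegular L v a → stableOrbitalIntegralRel (IsLocalStablyConjH L v) mH g a = 0) →
        ∫ h, g h ∂νH = 0 := by
  intro L _ _ _ v hs _ _ νH _ _ mH hcan g hg hvan
  obtain ⟨w, hw⟩ := hs
  have hΦ₂' : ((Matrix.of fun i j : Fin 2 => if i.val + j.val + 1 = 2 then (1 : L) else 0).map (cmConjRingHom L))ᵀ =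
      Matrix.of fun i j : Fin 2 => if i.val + j.val + 1 = 2 then (1 : L) else 0 := by
    ext i j; fin_cases i <;> fin_cases j <;> simp
  have hΦ₂d : (Matrix.of fun i j : Fin 2 => if i.val + j.val + 1 = 2 then (1 : L) else 0).det ≠ 0 := by
    rw [Matrix.det_fin_two]; simp
  have hΦ₁' : ((Matrix.of fun i j : Fin 1 => if i.val + j.val + 1 = 1 then (1 : L) else 0).map (cmConjRingHom L))ᵀ =
      Matrix.of fun i j : Fin 1 => if i.val + j.val + 1 = 1 then (1 : L) else 0 := by
    ext i j; fin_cases i; fin_cases j; simp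
  have hΦ₁d : (Matrix.of fun i j : Fin 1 => if i.val + j.val + 1 = 1 then (1 : L) else 0).det ≠ 0 := by
    rw [Matrix.det_fin_one, Matrix.of_apply]; simp
  refine hW L v ⟨w, hw⟩ νH mH hcan g hg (fun a ha => ?_)
  rw [← stableOrbitalIntegralRel_isLocalStablyConjH_eq_of_split L w hw hΦ₂' hΦ₂d hΦ₁' hΦ₁d mH g a]
  exact hvan a ha

/-- (W1s) + (C2-red) ⇒ ED. 3's `stub_charDistStableOfInvariant` statement (C2) AT SPLIT PLACES (ED. 15: one binder `(∃ w ∣ v, c • w ≠ w) →` added after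
`v`; ED. 4–14 had it at all places from (W1)), kept as a THEOREM so that `charDistStable_of_split` and the composition below change only by that binder:
`χ_ξ(f₁) − χ_ξ(f₂) = ∫ ξ(f₁ − f₂) = 0`. [folklore] -/
theorem charDistStableOfInvariant_of_line (hW1 : type_of% @F0P3bWeylVanishingSplit.weylVanishingSplit) (hred : type_of% @F0P3bCharDistReduction.charDistReduction) :
  ∀ (L : Type) [Field L] [NumberField L] [IsCMField L] (v : (HeightOneSpectrum (𝓞 ↥(maximalRealSubfield L)))), (∃ w : PlacesOver L v, IsCMField.complexConj L • w.1 ≠ w.1) →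
    ∀ [MeasurableSpace (((UnitaryGroup.cmDatum L 2 (Matrix.of fun i j : Fin 2 => if i.val + j.val + 1 = 2 then (1 : L) else 0)).Local v × (UnitaryGroup.cmDatum L 1 (Matrix.of fun i j : Fin 1 => if i.val + j.val + 1 = 1 then (1 : L) else 0)).Local v))] [BorelSpace (((UnitaryGroup.cmDatum L 2 (Matrix.of fun i j : Fin 2 => if i.val + j.val + 1 = 2 then (1 : L) else 0)).Local v × (UnitaryGroup.cmDatum L 1 (Matrix.of fun i j : Fin 1 => if i.val + j.val + 1 = 1 then (1 : L) else 0)).Local v))] (νH : Measure (((UnitaryGroup.cmDatum L 2 (Matrix.of fun i j : Fin 2 => if i.val + j.val + 1 = 2 then (1 : L) else 0)).Local v × (UnitaryGroup.cmDatum L 1 (Matrix.of fun i j : Fin 1 => if i.val + j.val + 1 = 1 then (1 : L) else 0)).Local v))) [νH.IsHaarMeasure] [νH.IsMulRightInvariant],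
    letI : ∀ a : ((UnitaryGroup.cmDatum L 2 (Matrix.of fun i j : Fin 2 => if i.val + j.val + 1 = 2 then (1 : L) else 0)).Local v × (UnitaryGroup.cmDatum L 1 (Matrix.of fun i j : Fin 1 => if i.val + j.val + 1 = 1 then (1 : L) else 0)).Local v), MeasurableSpace (((UnitaryGroup.cmDatum L 2 (Matrix.of fun i j : Fin 2 => if i.val + j.val + 1 = 2 then (1 : L) else 0)).Local v × (UnitaryGroup.cmDatum L 1 (Matrix.of fun i j : Fin 1 => if i.val + j.val + 1 = 1 then (1 : L) else 0)).Local v) ⧸ Subgroup.centralizer ({a} : Set (((UnitaryGroup.cmDatum L 2 (Matrix.of fun i j : Fin 2 => if i.val + j.val + 1 = 2 then (1 : L) else 0)).Local v × (UnitaryGroup.cmDatum L 1 (Matrix.of fun i j : Fin 1 => if i.val + j.val + 1 = 1 then (1 : L) else 0)).Local v)))) := fun _ => borel _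
    haveI : ∀ a : ((UnitaryGroup.cmDatum L 2 (Matrix.of fun i j : Fin 2 => if i.val + j.val + 1 = 2 then (1 : L) else 0)).Local v × (UnitaryGroup.cmDatum L 1 (Matrix.of fun i j : Fin 1 => if i.val + j.val + 1 = 1 then (1 : L) else 0)).Local v), BorelSpace (((UnitaryGroup.cmDatum L 2 (Matrix.of fun i j : Fin 2 => if i.val + j.val + 1 = 2 then (1 : L) else 0)).Local v × (UnitaryGroup.cmDatum L 1 (Matrix.of fun i j : Fin 1 => if i.val + j.val + 1 = 1 then (1 : L) else 0)).Local v) ⧸ Subgroup.centralizer ({a} : Set (((UnitaryGroup.cmDatum L 2 (Matrix.of fun i j : Fin 2 => if i.val + j.val + 1 = 2 then (1 : L) else 0)).Local v × (UnitaryGroup.cmDatum L 1 (Matrix.of fun i j : Fin 1 => if i.val + j.val + 1 = 1 then (1 : L) else 0)).Local v)))) := fun _ => ⟨rfl⟩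
    ∀ (mH : OrbitalMeasureFamily (((UnitaryGroup.cmDatum L 2 (Matrix.of fun i j : Fin 2 => if i.val + j.val + 1 = 2 then (1 : L) else 0)).Local v × (UnitaryGroup.cmDatum L 1 (Matrix.of fun i j : Fin 1 => if i.val + j.val + 1 = 1 then (1 : L) else 0)).Local v))), mH.IsCanonical (IsLocalGRegular L v) νH →
      ∀ (ξv : ((UnitaryGroup.cmDatum L 2 (Matrix.of fun i j : Fin 2 => if i.val + j.val + 1 = 2 then (1 : L) else 0)).Local v × (UnitaryGroup.cmDatum L 1 (Matrix.of fun i j : Fin 1 => if i.val + j.val + 1 = 1 then (1 : L) else 0)).Local v) →* ℂˣ), Continuous (fun x => (ξv x : ℂ)) →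
      (∀ a b : ((UnitaryGroup.cmDatum L 2 (Matrix.of fun i j : Fin 2 => if i.val + j.val + 1 = 2 then (1 : L) else 0)).Local v × (UnitaryGroup.cmDatum L 1 (Matrix.of fun i j : Fin 1 => if i.val + j.val + 1 = 1 then (1 : L) else 0)).Local v), IsLocalGRegular L v a → IsLocalStablyConjH L v a b → ξv a = ξv b) →
      ∀ (fH₁ fH₂ : ((UnitaryGroup.cmDatum L 2 (Matrix.of fun i j : Fin 2 => if i.val + j.val + 1 = 2 then (1 : L) else 0)).Local v × (UnitaryGroup.cmDatum L 1 (Matrix.of fun i j : Fin 1 => if i.val + j.val + 1 = 1 then (1 : L) else 0)).Local v) → ℂ), IsLocSmooth fH₁ → IsLocSmooth fH₂ →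
        (∀ a : ((UnitaryGroup.cmDatum L 2 (Matrix.of fun i j : Fin 2 => if i.val + j.val + 1 = 2 then (1 : L) else 0)).Local v × (UnitaryGroup.cmDatum L 1 (Matrix.of fun i j : Fin 1 => if i.val + j.val + 1 = 1 then (1 : L) else 0)).Local v), IsLocalGRegular L v a →
          stableOrbitalIntegralRel (IsLocalStablyConjH L v) mH fH₁ a = stableOrbitalIntegralRel (IsLocalStablyConjH L v) mH fH₂ a) →
        charDist ξv νH fH₁ = charDist ξv νH fH₂ := by
  intro L _ _ _ v hs _ _ νH _ _ mH hcan ξv hξc hξst fH₁ fH₂ h₁ h₂ hst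
  obtain ⟨hsm, hvan, hdiff⟩ := hred L v νH mH hcan ξv hξc hξst fH₁ fH₂ h₁ h₂ hst
  exact sub_eq_zero.mp (hdiff.trans (stableWeylVanishing_of_split hW1 L v hs νH mH hcan _ hsm hvan))

/-- (C1) + (W1s) + (C2-red) ⇒ ED. 1∕2's `stub_charDistStable` statement AT SPLIT PLACES (ED. 15: one binder `(∃ w ∣ v, c • w ≠ w) →` added after `v`,
exactly as the composition's `hS2` consumes it; kept as a THEOREM; ED. 4: (C2) enters as the theorem `charDistStableOfInvariant_of_line`). [folklore] -/
theorem charDistStable_of_split (hC1 : type_of% @F0P3bXiStablyInvariant.xiStablyInvariant) (hW1 : type_of% @F0P3bWeylVanishingSplit.weylVanishingSplit)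
    (hred : type_of% @F0P3bCharDistReduction.charDistReduction) :
  ∀ (L : Type) [Field L] [NumberField L] [IsCMField L] (v : (HeightOneSpectrum (𝓞 ↥(maximalRealSubfield L)))), (∃ w : PlacesOver L v, IsCMField.complexConj L • w.1 ≠ w.1) →
    ∀ [MeasurableSpace (((UnitaryGroup.cmDatum L 2 (Matrix.of fun i j : Fin 2 => if i.val + j.val + 1 = 2 then (1 : L) else 0)).Local v × (UnitaryGroup.cmDatum L 1 (Matrix.of fun i j : Fin 1 => if i.val + j.val + 1 = 1 then (1 : L) else 0)).Local v))] [BorelSpace (((UnitaryGroup.cmDatum L 2 (Matrix.of fun i j : Fin 2 => if i.val + j.val + 1 = 2 then (1 : L) else 0)).Local v × (UnitaryGroup.cmDatum L 1 (Matrix.of fun i j : Fin 1 => if i.val + j.val + 1 = 1 then (1 : L) else 0)).Local v))] (νH : Measure (((UnitaryGroup.cmDatum L 2 (Matrix.of fun i j : Fin 2 => if i.val + j.val + 1 = 2 then (1 : L) else 0)).Local v × (UnitaryGroup.cmDatum L 1 (Matrix.of fun i j : Fin 1 => if i.val + j.val + 1 = 1 then (1 : L) else 0)).Local v))) [νH.IsHaarMeasure]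 [νH.IsMulRightInvariant],
    letI : ∀ a : ((UnitaryGroup.cmDatum L 2 (Matrix.of fun i j : Fin 2 => if i.val + j.val + 1 = 2 then (1 : L) else 0)).Local v × (UnitaryGroup.cmDatum L 1 (Matrix.of fun i j : Fin 1 => if i.val + j.val + 1 = 1 then (1 : L) else 0)).Local v), MeasurableSpace (((UnitaryGroup.cmDatum L 2 (Matrix.of fun i j : Fin 2 => if i.val + j.val + 1 = 2 then (1 : L) else 0)).Local v × (UnitaryGroup.cmDatum L 1 (Matrix.of fun i j : Fin 1 => if i.val + j.val + 1 = 1 then (1 : L) else 0)).Local v) ⧸ Subgroup.centralizer ({a} : Set (((UnitaryGroup.cmDatum L 2 (Matrix.of fun i j : Fin 2 => if i.val + j.val + 1 = 2 then (1 : L) else 0)).Local v × (UnitaryGroup.cmDatum L 1 (Matrix.of fun i j : Fin 1 => if i.val + j.val + 1 = 1 then (1 : L) else 0)).Local v)))) := fun _ => borel _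
    haveI : ∀ a : ((UnitaryGroup.cmDatum L 2 (Matrix.of fun i j : Fin 2 => if i.val + j.val + 1 = 2 then (1 : L) else 0)).Local v × (UnitaryGroup.cmDatum L 1 (Matrix.of fun i j : Fin 1 => if i.val + j.val + 1 = 1 then (1 : L) else 0)).Local v), BorelSpace (((UnitaryGroup.cmDatum L 2 (Matrix.of fun i j : Fin 2 => if i.val + j.val + 1 = 2 then (1 : L) else 0)).Local v × (UnitaryGroup.cmDatum L 1 (Matrix.of fun i j : Fin 1 => if i.val + j.val + 1 = 1 then (1 : L) else 0)).Local v) ⧸ Subgroup.centralizer ({a} : Set (((UnitaryGroup.cmDatum L 2 (Matrix.of fun i j : Fin 2 => if i.val + j.val + 1 = 2 then (1 : L) else 0)).Local v × (UnitaryGroup.cmDatum L 1 (Matrix.of fun i j : Fin 1 => if i.val + j.val + 1 = 1 then (1 : L) else 0)).Local v)))) := fun _ => ⟨rfl⟩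
    ∀ (mH : OrbitalMeasureFamily (((UnitaryGroup.cmDatum L 2 (Matrix.of fun i j : Fin 2 => if i.val + j.val + 1 = 2 then (1 : L) else 0)).Local v × (UnitaryGroup.cmDatum L 1 (Matrix.of fun i j : Fin 1 => if i.val + j.val + 1 = 1 then (1 : L) else 0)).Local v))), mH.IsCanonical (IsLocalGRegular L v) νH →
      ∀ (ξv : ((UnitaryGroup.cmDatum L 2 (Matrix.of fun i j : Fin 2 => if i.val + j.val + 1 = 2 then (1 : L) else 0)).Local v × (UnitaryGroup.cmDatum L 1 (Matrix.of fun i j : Fin 1 => if i.val + j.val + 1 = 1 then (1 : L) else 0)).Local v) →* ℂˣ), Continuous (fun x => (ξv x : ℂ)) →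
      ∀ (fH₁ fH₂ : ((UnitaryGroup.cmDatum L 2 (Matrix.of fun i j : Fin 2 => if i.val + j.val + 1 = 2 then (1 : L) else 0)).Local v × (UnitaryGroup.cmDatum L 1 (Matrix.of fun i j : Fin 1 => if i.val + j.val + 1 = 1 then (1 : L) else 0)).Local v) → ℂ), IsLocSmooth fH₁ → IsLocSmooth fH₂ →
        (∀ a : ((UnitaryGroup.cmDatum L 2 (Matrix.of fun i j : Fin 2 => if i.val + j.val + 1 = 2 then (1 : L) else 0)).Local v × (UnitaryGroup.cmDatum L 1 (Matrix.of fun i j : Fin 1 => if i.val + j.val + 1 = 1 then (1 : L) else 0)).Local v), IsLocalGRegular L v a →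
          stableOrbitalIntegralRel (IsLocalStablyConjH L v) mH fH₁ a = stableOrbitalIntegralRel (IsLocalStablyConjH L v) mH fH₂ a) →
        charDist ξv νH fH₁ = charDist ξv νH fH₂ := by
  intro L _ _ _ v hs _ _ νH _ _ mH hcan ξv hξ fH₁ fH₂ h₁ h₂ hst
  exact charDistStableOfInvariant_of_line hW1 hred L v hs νH mH hcan ξv hξ (fun a b _ hab => hC1 L v ξv a b hab) fH₁ fH₂ h₁ h₂ hst

/-- GLUE (ED. 10, kernel-checked): (N-H-ii′) ⇒ (N-H) — take `π₁ := IrrClass.mk (SmoothIrrep.ofChar (ξ.xiLocalChar v) hker)`; conjunct 2 is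
★ `IrrClass.smoothTrace_mk_ofChar_of_mem` (p841475) since the stub's `IsLocSmooth fH` IS `fH ∈ SchwartzBruhat _` (both `IsLocallyConstant ∧ HasCompactSupport`). -/
theorem hPrincipalSeriesLabels_of_JH (hJH : type_of% (F0P3bHPrincipalSeriesJHOfUTwo.hPrincipalSeriesJH_of_uTwo (F0P3bU2PrincipalSeriesJHOfBricks.uTwoPrincipalSeriesJH_of_bricks F0P3bHPrincipalSeriesJHHolds.hHC_holds F0P3bU2XiQuotientFunctional.xi_quotient_functional F0P3bU2NoCharacterEigenvector.no_char_eigenvector_cmPrincipalSeries_two))) :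
  ∀ (L : Type) [Field L] [NumberField L] [IsCMField L] (v : (HeightOneSpectrum (𝓞 ↥(maximalRealSubfield L))))
    [MeasurableSpace (((UnitaryGroup.cmDatum L 2 (Matrix.of fun i j : Fin 2 => if i.val + j.val + 1 = 2 then (1 : L) else 0)).Local v × (UnitaryGroup.cmDatum L 1 (Matrix.of fun i j : Fin 1 => if i.val + j.val + 1 = 1 then (1 : L) else 0)).Local v))] [BorelSpace (((UnitaryGroup.cmDatum L 2 (Matrix.of fun i j : Fin 2 => if i.val + j.val + 1 = 2 then (1 : L) else 0)).Local v × (UnitaryGroup.cmDatum L 1 (Matrix.of fun i j : Fin 1 => if i.val + j.val + 1 = 1 then (1 : L) else 0)).Local v))] (νH : Measure (((UnitaryGroup.cmDatum L 2 (Matrix.of fun i j : Fin 2 => if i.val + j.val + 1 = 2 then (1 : L) else 0)).Local v × (UnitaryGroup.cmDatum L 1 (Matrix.of fun i j : Fin 1 => if i.val + j.val + 1 = 1 then (1 : L) else 0)).Local v))) [νH.IsHaarMeasure] [νH.IsMulRightInvariant]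
    (ξ : OneDimAutRepH L), (∀ w : PlacesOver L v, IsCMField.complexConj L • w.1 = w.1) →
      ∃ π₁ πSt : IrrClass (((UnitaryGroup.cmDatum L 2 (Matrix.of fun i j : Fin 2 => if i.val + j.val + 1 = 2 then (1 : L) else 0)).Local v × (UnitaryGroup.cmDatum L 1 (Matrix.of fun i j : Fin 1 => if i.val + j.val + 1 = 1 then (1 : L) else 0)).Local v)),
        HLengthTwoLabels L v
          (torusCharPair (conjLocal L (IsCMField.complexConj L) v) (cmLocalForm L 2 v) (cmLocalForm_eq_over L 2 v) 0
            ((torusLocalComponent L (IsCMField.complexConj L) v ξ.η).comp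
                (quotConj (conjLocal L (IsCMField.complexConj L) v) (conjLocal_conjLocal_cm L v)) *
              halfModulusChar (UnitaryGroup.LocalRing L v))
            (torusLocalComponent L (IsCMField.complexConj L) v ξ.ψ))
          ((torusLocalComponent L (IsCMField.complexConj L) v ξ.ψ).comp (localDet (IsCMField.complexConj L) v (isUnit_antidiagOne_det L 1))) π₁ πSt ∧
        (∀ fH : ((UnitaryGroup.cmDatum L 2 (Matrix.of fun i j : Fin 2 => if i.val + j.val + 1 = 2 then (1 : L) else 0)).Local v × (UnitaryGroup.cmDatum L 1 (Matrix.of fun i j : Fin 1 => if i.val + j.val + 1 = 1 then (1 : L) else 0)).Local v) → ℂ, IsLocSmooth fH → π₁.smoothTrace νH fH = charDist (ξ.xiLocalChar v) νH fH) ∧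
        (∀ fH : ((UnitaryGroup.cmDatum L 2 (Matrix.of fun i j : Fin 2 => if i.val + j.val + 1 = 2 then (1 : L) else 0)).Local v × (UnitaryGroup.cmDatum L 1 (Matrix.of fun i j : Fin 1 => if i.val + j.val + 1 = 1 then (1 : L) else 0)).Local v) → ℂ, IsLocSmooth fH →
          Representation.smoothTrace
              (UnitaryGroup.cmPrincipalSeriesH L v
                (torusCharPair (conjLocal L (IsCMField.complexConj L) v) (cmLocalForm L 2 v) (cmLocalForm_eq_over L 2 v) 0
                  ((torusLocalComponent L (IsCMField.complexConj L) v ξ.η).comp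
                      (quotConj (conjLocal L (IsCMField.complexConj L) v) (conjLocal_conjLocal_cm L v)) *
                    halfModulusChar (UnitaryGroup.LocalRing L v))
                  (torusLocalComponent L (IsCMField.complexConj L) v ξ.ψ))
                ((torusLocalComponent L (IsCMField.complexConj L) v ξ.ψ).comp (localDet (IsCMField.complexConj L) v (isUnit_antidiagOne_det L 1))))
              νH fH = π₁.smoothTrace νH fH + πSt.smoothTrace νH fH) := by
  intro L _ _ _ v _ _ νH _ _ ξ hns
  obtain ⟨πSt, hker, hlab, hadd⟩ := hJH L v νH ξ hns
  refine ⟨IrrClass.mk (SmoothIrrep.ofChar (ξ.xiLocalChar v) hker), πSt, hlab, fun fH hfH => ?_, hadd⟩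
  haveI := F0P3bCharDistReduction.nonarchimedeanGroup_HLoc L v
  exact IrrClass.smoothTrace_mk_ofChar_of_mem νH hker ⟨hfH.1, hfH.2⟩

end Summit.HodgeConjecture.HodgeConjecture.Cruxes.H413.F0P3bQCMTSignedOfLinePieces

end
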